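import Summits.NavierStokesRegularity.TurbBounds.Certs.N1prime.EvalRule
import Summits.NavierStokesRegularity.TurbBounds.TailN1primePieces1
import Summits.NavierStokesRegularity.TurbBounds.TailN1primePieces2
import Summits.NavierStokesRegularity.TurbBounds.TailN1primePieces3
import Summits.NavierStokesRegularity.TurbBounds.TailN1primePieces4
import Summits.NavierStokesRegularity.TurbBounds.TailN1primePieces5
import Summits.NavierStokesRegularity.TurbBounds.TailN1primePieces6
import Summits.NavierStokesRegularity.TurbBounds.TailN1primePieces7
import Summits.NavierStokesRegularity.TurbBounds.TailN1primePieces8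
import Summits.NavierStokesRegularity.TurbBounds.TailN1primePieces9
import Summits.NavierStokesRegularity.TurbBounds.TailN1primePieces10
import Summits.NavierStokesRegularity.TurbBounds.TailN1primePieces11
import Summits.NavierStokesRegularity.TurbBounds.TailN1primePieces12
import Summits.NavierStokesRegularity.TurbBounds.TailN1primePieces13
import Summits.NavierStokesRegularity.TurbBounds.TailN1primePieces14
import Summits.NavierStokesRegularity.TurbBounds.TailPolyGenW
import HarnessLib

/-!
# Row RB-N1′ tail lemma (dim 62) — glue: the tracked finite part `finGenW 24 6 a0 s` IS the quadratic form of the literal projected rule `MelR`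
at the kept vector (cell `pub-turb` / `turb-bounds`; v2; partly GENERATED by pub-turb-cert gen 7 `emit_rbP.py N1prime` (merge of tailgen/emit/emit_tail.py and emit_rb.py). Uses the 14 structured
piece identities (`TailN1primePieces1–14`), the ladder dictionary under the far-wall conditions `c 0 = c 1 = 0`, `d 0 = 0`, `couplingMode_congr`,
and `ring` over opaque Parseval sums and `couplingMode` atoms — the coupling is never expanded here.)

HONEST FRAMING: rigorous bounds for the stated PDE and boundary conditions; no claim about physical turbulence beyond the bound.
-/

set_option linter.style.longLine false
set_option linter.style.setOption false

noncomputable section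

namespace Summit.NavierStokesRegularity.TurbBounds.TailN1prime

open Polynomial Finset Matrix Literature.Computation.Certificates
open Summit.NavierStokesRegularity.TurbBounds.LadderTail (w IsLadder phi lam)
open Summit.NavierStokesRegularity.TurbBounds.CouplingSplit (couplingExact couplingMode couplingMode_congr couplingExact_eq_sum_modes)
open Summit.NavierStokesRegularity.TurbBounds.TailPolyGenW (finGenW)
open Summit.NavierStokesRegularity.TurbBounds.Certs.N1prime.Evaluator

/-- The profile's literal Legendre data as a real sequence: `ĝ_0 = −s`, `ĝ_p = φ̂_p` (`1 ≤ p ≤ 6`), zero beyond. -/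
def ghatR : ℕ → ℝ
  | 0 => ghat0 | 1 => ghat1 | 2 => ghat2 | 3 => ghat3 | 4 => ghat4 | 5 => ghat5 | 6 => ghat6 | _ => 0

/-- quadratic forms are additive in the (rational) matrix -/
theorem qf_add (A B : Matrix (Fin 62) (Fin 62) ℚ) (x : Fin 62 → ℝ) :
    x ⬝ᵥ ((A + B).map (Rat.cast : ℚ → ℝ) *ᵥ x) = x ⬝ᵥ (A.map (Rat.cast : ℚ → ℝ) *ᵥ x) + x ⬝ᵥ (B.map (Rat.cast : ℚ → ℝ) *ᵥ x) := by
  have h : (A + B).map (Rat.cast : ℚ → ℝ) = A.map (Rat.cast : ℚ → ℝ) + B.map (Rat.cast : ℚ → ℝ) := by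
    ext i j; simp [Matrix.map_apply]
  rw [h, add_mulVec, dotProduct_add]

/-- quadratic forms are homogeneous in the (rational) matrix -/
theorem qf_smul (q : ℚ) (A : Matrix (Fin 62) (Fin 62) ℚ) (x : Fin 62 → ℝ) :
    x ⬝ᵥ ((q • A).map (Rat.cast : ℚ → ℝ) *ᵥ x) = (q : ℝ) * (x ⬝ᵥ (A.map (Rat.cast : ℚ → ℝ) *ᵥ x)) := by
  have h : (q • A).map (Rat.cast : ℚ → ℝ) = (q : ℝ) • A.map (Rat.cast : ℚ → ℝ) := by
    ext i j; simp [Matrix.map_apply]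
  rw [h, smul_mulVec, dotProduct_smul, smul_eq_mul]

/-- quadratic forms are homogeneous in a real scalar on the real matrix -/
theorem qf_smulR (r : ℝ) (A : Matrix (Fin 62) (Fin 62) ℝ) (x : Fin 62 → ℝ) :
    x ⬝ᵥ ((r • A) *ᵥ x) = r * (x ⬝ᵥ (A *ᵥ x)) := by
  rw [smul_mulVec, dotProduct_smul, smul_eq_mul]

/-- `xᵀ·MelR(ε;u,v)·x` (real Young weight `ε`, real data `u, v`) as the weighted sum of the 14 piece forms. -/
theorem quadForm_MelR_pieces (ε u v : ℝ) (x : Fin 62 → ℝ) :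
    x ⬝ᵥ (MelR ε u v *ᵥ x)
      = ((a0 : ℚ) : ℝ) * (x ⬝ᵥ (PW0.map (Rat.cast : ℚ → ℝ) *ᵥ x)) + ((s : ℚ) : ℝ) * (x ⬝ᵥ (PT0.map (Rat.cast : ℚ → ℝ) *ᵥ x))
        + ((ghat0 : ℚ) : ℝ) * (x ⬝ᵥ (CE0.map (Rat.cast : ℚ → ℝ) *ᵥ x)) + ((ghat1 : ℚ) : ℝ) * (x ⬝ᵥ (CE1.map (Rat.cast : ℚ → ℝ) *ᵥ x)) + ((ghat2 : ℚ) : ℝ) * (x ⬝ᵥ (CE2.map (Rat.cast : ℚ → ℝ) *ᵥ x)) + ((ghat3 : ℚ) : ℝ) * (x ⬝ᵥ (CE3.map (Rat.cast : ℚ → ℝ) *ᵥ x)) + ((ghat4 : ℚ) : ℝ) * (x ⬝ᵥ (CE4.map (Rat.cast : ℚ → ℝ) *ᵥ x)) + ((ghat5 : ℚ) : ℝ) * (x ⬝ᵥ (CE5.map (Rat.cast : ℚ → ℝ) *ᵥ x)) + ((ghat6 : ℚ) : ℝ) * (x ⬝ᵥ (CE6.map (Rat.cast : ℚ → ℝ)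 *ᵥ x))
        + (-(((T : ℚ) : ℝ) * ε)) * (x ⬝ᵥ (TW.map (Rat.cast : ℚ → ℝ) *ᵥ x)) + (-(((T : ℚ) : ℝ) / ε)) * (x ⬝ᵥ (TT.map (Rat.cast : ℚ → ℝ) *ᵥ x))
        + u * (((a0 : ℚ) : ℝ) * (x ⬝ᵥ (PWu.map (Rat.cast : ℚ → ℝ) *ᵥ x)))
        + v * (((a0 : ℚ) : ℝ) * (x ⬝ᵥ (PWv.map (Rat.cast : ℚ → ℝ) *ᵥ x)) + ((s : ℚ) : ℝ) * (x ⬝ᵥ (PTv.map (Rat.cast : ℚ → ℝ) *ᵥ x))) := by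
  rw [MelR_eq5]
  simp only [add_mulVec, dotProduct_add, qf_smulR, Mb, Acoef, Bcoef, qf_add, qf_smul]
  ring

set_option maxRecDepth 100000 in
set_option maxHeartbeats 20000000 in
/-- **Bridge (RB-N1′)**: on coefficient sequences linked by the integration ladders AND satisfying the far-wall conditions `c 0 = c 1 = 0`,
`d 0 = 0` (the two-sided no-slip class), the tracked finite part `finGenW 24 6 a0 s` (with the literal profile data `ĝ`) at `(u, v, ε)` equals the
quadratic form of the literal projected rule `MelR ε u v` at the kept vector. -/
theorem finGenW_eq_quadForm {c a b d e : ℕ → ℝ} (hA : IsLadder c a) (hB : IsLadder a b) (hE : IsLadder d e)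
    (ha0 : a 0 = c 0 - c 1 / 3) (hb0 : b 0 = a 0 - a 1 / 3) (he0 : e 0 = d 0 - d 1 / 3) (hc0 : c 0 = 0) (hc1 : c 1 = 0) (hd0 : d 0 = 0)
    (ε u v : ℝ) :
    finGenW 24 6 ((a0 : ℚ) : ℝ) ((s : ℚ) : ℝ) u v ε ((T : ℚ) : ℝ) ghatR c a b d e = (stack c d) ⬝ᵥ (MelR ε u v *ᵥ stack c d) := by
  have hxc := xc_stack c d hc0 hc1
  have hxd := xd_stack c d hd0
  have haL := aL_stack (d := d) hA ha0 hc0 hc1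
  have hbL := bL_stack (d := d) hA hB ha0 hb0 hc0 hc1
  have heL := eL_stack c hE he0 hd0
  have hM0 : couplingMode 24 6 0 (bL (stack c d)) (eL (stack c d)) = couplingMode 24 6 0 b e :=
    couplingMode_congr (fun n hn => hbL n (by omega)) (fun m hm => heL m (by omega))
  have hM1 : couplingMode 24 6 1 (bL (stack c d)) (eL (stack c d)) = couplingMode 24 6 1 b e :=
    couplingMode_congr (fun n hn => hbL n (by omega)) (fun m hm => heL m (by omega))
  have hM2 : couplingMode 24 6 2 (bL (stack c d)) (eL (stack c d)) = couplingMode 24 6 2 b e :=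
    couplingMode_congr (fun n hn => hbL n (by omega)) (fun m hm => heL m (by omega))
  have hM3 : couplingMode 24 6 3 (bL (stack c d)) (eL (stack c d)) = couplingMode 24 6 3 b e :=
    couplingMode_congr (fun n hn => hbL n (by omega)) (fun m hm => heL m (by omega))
  have hM4 : couplingMode 24 6 4 (bL (stack c d)) (eL (stack c d)) = couplingMode 24 6 4 b e :=
    couplingMode_congr (fun n hn => hbL n (by omega)) (fun m hm => heL m (by omega))
  have hM5 : couplingMode 24 6 5 (bL (stack c d)) (eL (stack c d)) = couplingMode 24 6 5 b e :=
    couplingMode_congr (fun n hn => hbL n (by omega)) (fun m hm => heL m (by omega))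
  have hM6 : couplingMode 24 6 6 (bL (stack c d)) (eL (stack c d)) = couplingMode 24 6 6 b e :=
    couplingMode_congr (fun n hn => hbL n (by omega)) (fun m hm => heL m (by omega))
  have hsc : ∑ n ∈ range 33, w n * xc (stack c d) n ^ 2 = ∑ n ∈ range 33, w n * c n ^ 2 :=
    sum_congr rfl fun n hn => by rw [hxc n (Finset.mem_range.mp hn)]
  have hsa : ∑ n ∈ range 32, w n * aL (stack c d) n ^ 2 = ∑ n ∈ range 32, w n * a n ^ 2 :=
    sum_congr rfl fun n hn => by rw [haL n (Finset.mem_range.mp hn)]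
  have hsb : ∑ n ∈ range 31, w n * bL (stack c d) n ^ 2 = ∑ n ∈ range 31, w n * b n ^ 2 :=
    sum_congr rfl fun n hn => by rw [hbL n (Finset.mem_range.mp hn)]
  have hsd : ∑ n ∈ range 32, w n * xd (stack c d) n ^ 2 = ∑ n ∈ range 32, w n * d n ^ 2 :=
    sum_congr rfl fun n hn => by rw [hxd n (Finset.mem_range.mp hn)]
  have hse : ∑ n ∈ range 31, w n * eL (stack c d) n ^ 2 = ∑ n ∈ range 31, w n * e n ^ 2 :=
    sum_congr rfl fun n hn => by rw [heL n (Finset.mem_range.mp hn)]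
  rw [quadForm_MelR_pieces, quadForm_PW0, quadForm_PT0, quadForm_TW, quadForm_TT, quadForm_PWu, quadForm_PWv, quadForm_PTv, quadForm_CE0, quadForm_CE1, quadForm_CE2, quadForm_CE3, quadForm_CE4, quadForm_CE5, quadForm_CE6]
  rw [hM0, hM1, hM2, hM3, hM4, hM5, hM6, hsc, hsa, hsb, hsd, hse]
  rw [hbL 25 (by norm_num), hbL 26 (by norm_num), hbL 27 (by norm_num), hbL 28 (by norm_num), hbL 29 (by norm_num), hbL 30 (by norm_num), haL 30 (by norm_num), haL 31 (by norm_num), hxc 31 (by norm_num), hxc 32 (by norm_num),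
    heL 25 (by norm_num), heL 26 (by norm_num), heL 27 (by norm_num), heL 28 (by norm_num), heL 29 (by norm_num), heL 30 (by norm_num), hxd 30 (by norm_num), hxd 31 (by norm_num)]
  unfold finGenW
  rw [couplingExact_eq_sum_modes]
  simp only [sum_range_succ, sum_range_zero, zero_add, Nat.reduceAdd, ghatR]
  ring

end Summit.NavierStokesRegularity.TurbBounds.TailN1prime

end
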